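import Mathlib
import Literature.RingTheory.TightClosure.TightClosure
import Summits.ResolutionOfSingularities.ResolutionOfSingularities.Theses.FrobeniusLadder

/-!
# Sketch — first lemmas of the crux ideas for `FInjectiveMacaulayfication`
(crux stmt-ResolutionOfSingularities-15315, route FrobeniusLadder; ideator 1, round 1).

Only signatures are required to elaborate; proofs are `sorry` (crux-ideate stage, no skeleton).
-/

namespace Summit.ResolutionOfSingularities.ResolutionOfSingularities.Cruxes.FInjectiveMacaulayfication.SketchIdeator1

open Literature.RingTheory.TightClosure

-- the crux, by name (sanity: the route decl is in scope)
#check @Summit.ResolutionOfSingularities.ResolutionOfSingularities.Theses.FrobeniusLadder.FInjectiveMacaulayfication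

/-! ## Idea `graded-cartier-criterion` -/

/-- PROPAGATION ("Proj forgets low degrees"): for a `p⁻¹`-linear operator `T` (model of the Cartier /
Grothendieck trace on the canonical module of a Gorenstein ring) and an ideal `𝔞`, Cartier-surjectivity
at `𝔞`-adic level `1` propagates to every level `n ≥ 1`. First lemma of the line. -/
theorem stub_propagation {R : Type*} [CommRing R] (p : ℕ) (T : R →+ R)
    (hT : ∀ r s : R, T (r ^ p * s) = r * T s) (𝔞 : Ideal R)
    (h1 : 𝔞 ≤ Ideal.span (T '' (↑(𝔞 ^ p) : Set R))) {n : ℕ} (hn : 1 ≤ n) :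
    𝔞 ^ n ≤ Ideal.span (T '' (↑(𝔞 ^ (p * n)) : Set R)) := by
  sorry

/-- PIGEONHOLE (few generators trap the Cartier image): an ideal generated by `ν` elements satisfies
`𝔞^(p n + (ν-1)(p-1)) ⊆ (𝔞^n)^[p]`; hence `T(F_* 𝔞^(p n + (ν-1)(p-1))) ⊆ 𝔞^n · T(F_* R)`, and a centre
with `ν ≤ c + 1` generators (`c` = canonical discrepancy shift of its blow-up, `c = d - 1` for a parameter
ideal) can never pass the graded Cartier criterion at a non-F-injective CM point. -/
theorem stub_pigeonhole {R : Type*} [CommRing R] (p : ℕ) (hp : p.Prime) {ν : ℕ} (g : Fin ν → R)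
    (n : ℕ) :
    (Ideal.span (Set.range g)) ^ (p * n + (ν - 1) * (p - 1)) ≤
      frobeniusPower p ((Ideal.span (Set.range g)) ^ n) := by
  sorry

/-- Consequence used by the no-go: the Cartier image of a deep power of a `ν`-generated ideal is trapped
in `𝔞^n · T(R)`. -/
theorem stub_trapped_image {R : Type*} [CommRing R] (p : ℕ) (hp : p.Prime) (T : R →+ R)
    (hT : ∀ r s : R, T (r ^ p * s) = r * T s) {ν : ℕ} (g : Fin ν → R) (n : ℕ) :
    Ideal.span (T '' (↑((Ideal.span (Set.range g)) ^ (p * n + (ν - 1) * (p - 1))) : Set R)) ≤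
      (Ideal.span (Set.range g)) ^ n * Ideal.span (Set.range T) := by
  sorry

/-! ## Idea `cartier-contraction-centres` -/

/-- THE CONTRACTION REFINES THE NAIVE CENTRE: for a `p⁻¹`-linear `T` and an ideal `𝔞` (the reduced ideal
of the non-F-injective locus, or `m`), the Cartier contraction `𝔠 := span T(𝔞^p)` contains
`𝔞 · span T(R)` (= `I_Z · σ₁` in the card) — the new `p`-th-root directions are what is added. -/
theorem stub_contraction_refines {R : Type*} [CommRing R] (p : ℕ) (T : R →+ R)
    (hT : ∀ r s : R, T (r ^ p * s) = r * T s) (𝔞 : Ideal R) :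
    𝔞 * Ideal.span (Set.range T) ≤ Ideal.span (T '' (↑(𝔞 ^ p) : Set R)) := by
  sorry

/-- STATIONARITY AT REGULAR POINTS OF DIMENSION ≥ 2 (polynomial model): with `T` the standard
`p⁻¹`-linear splitting of `k[x₁,…,x_d]` (`T(x^a) = x^((a-(p-1))/p)` on exponents `≡ p-1 (mod p)`, else `0`),
`d ≥ 2` gives `1 = T((x₁⋯x_d)^(p-1))` with `(x₁⋯x_d)^(p-1) ∈ m^p`, so the contraction of `m^p` is the unit
ideal and the tower does not touch regular points. Abstract form: if some `w ∈ 𝔞^p` has `T w = 1` then the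
contraction is `⊤`. -/
theorem stub_contraction_top_of_witness {R : Type*} [CommRing R] (p : ℕ) (T : R →+ R) (𝔞 : Ideal R)
    {w : R} (hw : w ∈ 𝔞 ^ p) (h1 : T w = 1) :
    Ideal.span (T '' (↑(𝔞 ^ p) : Set R)) = ⊤ := by
  sorry

/-! ## Idea `weakly-normal-centres` -/

/-- CALIBRATION NO-GO (every characteristic): on the chart `y = x·T` of the blow-up of the PARAMETER ideal
`(x, y)` of the rational double point `E₈⁰ : z² + x³ + y⁵ = 0`, i.e. on
`A = k[x, T, z]/(z² + x³ + x⁵ T⁵)`, one has `z ∉ (x)` but `z^p ∈ (x^p) = (x)^[p]`: the principal parameter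
ideal `(x)` of the one-dimensional local ring at the generic point of the exceptional curve `x = z = 0`
is not Frobenius closed (Frobenius closure localises, Quy–Shimomoto Lemma 3.2), so `Bl_(x,y) E₈⁰`
violates the crux predicate. Variables: `0 ↦ x, 1 ↦ T, 2 ↦ z`. -/
theorem stub_parameter_blowup_not_frobenius_closed (p : ℕ) (hp : p.Prime) (k : Type) [Field k]
    [CharP k p] :
    let f : MvPolynomial (Fin 3) k :=
      MvPolynomial.X 2 ^ 2 + MvPolynomial.X 0 ^ 3 + MvPolynomial.X 0 ^ 5 * MvPolynomial.X 1 ^ 5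
    let A := MvPolynomial (Fin 3) k ⧸ Ideal.span {f}
    let u : Fin 3 → A := fun i => Ideal.Quotient.mk (Ideal.span {f}) (MvPolynomial.X i)
    u 2 ∉ Ideal.span {u 0} ∧ u 2 ^ p ∈ Ideal.span {u 0 ^ p} := by
  sorry

/-- WEAK NORMALITY FROM THE CRUX PREDICATE IN DIMENSION ONE (Schwede 2009 Thm 4.7 / Quy–Shimomoto Rem. 3.10
in the crux's own language): if `x` is a non-zero-divisor of `R` and the principal ideal `(x)` is Frobenius
closed, then every `y` in an overring `B ⊇ R` with `x • y ∈ R`-denominator… — elementwise form: if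
`a ∈ R` satisfies `a^p ∈ (x^p)` then `a ∈ (x)`; i.e. `y = a/x` with `y^p ∈ R` forces `y ∈ R`. -/
theorem stub_frobenius_closed_principal_gives_pth_root_closed {R : Type*} [CommRing R] (p : ℕ)
    [ExpChar R p] (x a : R) (hx : IsFrobeniusClosed p (Ideal.span {x}))
    (ha : a ^ p ∈ Ideal.span {x ^ p}) : a ∈ Ideal.span {x} := by
  sorry

end Summit.ResolutionOfSingularities.ResolutionOfSingularities.Cruxes.FInjectiveMacaulayfication.SketchIdeator1
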